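import Summits.CriticalPhenomena.Ising3DConformalLimit.Theorems.GaussianScaleMixtureRotationUpgradeFromTwoPointNineMirrorRP
import Summits.CriticalPhenomena.Ising3DConformalLimit.Theorems.GaussianScaleMixtureRotationUpgradeFromTwoPointExteriorHarmonic
import Summits.CriticalPhenomena.Ising3DConformalLimit.Theorems.GaussianScaleMixtureRotationUpgradeFromTwoPointAnalyticOffFinite
import Summits.CriticalPhenomena.Ising3DConformalLimit.Theorems.GaussianScaleMixtureRotationUpgradeFromTwoPointEdgeBocherLiouville
import Summits.CriticalPhenomena.Ising3DConformalLimit.Theorems.GaussianScaleMixtureRotationUpgradeFromTwoPointSigmaBoundReduction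
import Summits.CriticalPhenomena.Ising3DConformalLimit.Theorems.RotationUpgradeFromTwoPoint.Negative.AutomaticOrders
import Summits.CriticalPhenomena.Ising3DConformalLimit.Theorems.HyperoctahedralRPLimitRotationInvariantAxisSigmaOfUnit
import HarnessLib

/-!
# Edge Gaussianity of the round Ising₃ limit, "interaction forces η > 0", and
# `RotationUpgradeFromTwoPoint` closed modulo its open core (line `null-laplacian-edge-gaussianity`)

THEOREM-ONLY file (no definitions).  Crux stmt-CriticalPhenomena-8367,
`GaussianScaleMixture.RotationUpgradeFromTwoPoint`: for `(ρ, Δ, S)` with (H1) `ρ > 0` on `(0,1]`,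
(H2) `HasPointwiseScalingLimit (criticalCorr 3) ρ S`, (H3) `S = 0` off `NonCoincident`, (H4) non-degenerate `S₂`,
(H5) translation invariance, (H6) scale covariance with `Δ`, (H7) round `S₂`, the family `S` is `IsRotationInvariant`.

With the four stubs of the line LANDED — `stub_nineMirrorRP` (nine-mirror reflection positivity of all orders),
`stub_exteriorHarmonic` (at `Δ = 1/2`, `x ↦ S_{m+1}(x, y)` is harmonic wherever a lattice mirror separates `x`
from `y`: the Osterwalder–Schrader null vector of the harmonic kernel `A‖θa - b‖⁻¹`), `stub_analyticOffFinite`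
(joint real-analyticity of `S_{m+1}(·, y)` off a finite set, every `Δ`), `stub_edgeBocherLiouville` (flooding +
removable singularities + GKS/Lebowitz + Liouville ⇒ `U₄ ≡ 0`) — the EDGE of the window `Δ ∈ [1/2, 1]` is settled
UNCONDITIONALLY (given the crux hypotheses), with no rotation in the statements:

* `edge_limitConnectedFour_eq_zero` — **η = 0 forces Gaussianity at order four**: `Δ = 1/2 ⇒ U₄ ≡ 0` on
  non-coincident quadruples.
* `half_lt_delta_of_hasNontrivialU4` — **interaction forces an anomalous dimension**: `U₄ ≢ 0 ⇒ 1/2 < Δ`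
  (the window `1/2 ≤ Δ` is `delta_mem_Icc_of_hyp`).
* `isRotationInvariant_of_delta_eq_half` — **the edge instance of the crux is PROVED**: `Δ = 1/2 ⇒ IsRotationInvariant S`
  (Gaussian alternative `isRotationInvariant_of_gaussian`, Aizenman–Newman dichotomy + Wick at all even orders).
* `rotationUpgradeFromTwoPoint_of_interiorSigmaBound` — **the crux closed modulo its open core** (kernel-checked
  composition of the registered skeleton, gen 3): if every INTERIOR, NON-GAUSSIAN instance (`1/2 < Δ ≤ 1`, `U₄ ≢ 0`),
  handed nine-mirror RP and the analytic layer for free, satisfies the frame-`e₀` axis sigma bound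
  `‖e^{-uH} σ̂(y) e^{-vH}‖ ≤ C (u^{-Δ} + v^{-Δ})` (registered stub `stub_interiorSigmaBound`, = the open core of the
  sibling crux stmt-1980), then the crux holds (Gaussian locus: `isRotationInvariant_of_gaussian`; edge: excluded by
  `half_lt_delta_of_hasNontrivialU4`; interior: the landed graft `stub_sigmaBoundGraft`, i.e. the `quarter-turn-liouville`
  machinery with base level `2` from (H7)).
* `rotationUpgradeFromTwoPoint_of_interiorUnitSigmaBound` — the same in DIMENSIONLESS form: hypothesis = the unit
  sigma bound `‖e^{-H} σ̂(y) e^{-H}‖ ≤ C₁` (registered stub `stub_interiorUnitSigmaBound`, skeleton gen 3.2), via the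
  landed `stub_axisSigmaBound_of_unit`.
-/

noncomputable section

open Literature.Probability.LatticeModels
open Literature.MathematicalPhysics.QuantumFieldTheory (axisReflection)
open Summit.CriticalPhenomena.Ising3DConformalLimit.RotationUpgradeFromTwoPointNegative
  (isRotationInvariant_of_gaussian delta_mem_Icc_of_hyp)
open Summit.CriticalPhenomena.Ising3DConformalLimit.Cruxes.LimitRotationInvariant.QuarterTurnLiouville
  (LimitStructure stub_limitRegularity stub_axisSigmaBound_of_unit)

namespace Summit.CriticalPhenomena.Ising3DConformalLimit.Cruxes.RotationUpgradeFromTwoPoint.NullLaplacianEdgeGaussianity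

variable {ρ : ℝ → ℝ} {Δ : ℝ} {S : CorrFamily 3}

/-- **η = 0 forces Gaussianity at order four.**  For every instance of the crux hypotheses (H1)–(H7) at the
EDGE `Δ = 1/2` of the window, the connected four-point function vanishes on non-coincident quadruples:
STUB 1 supplies nine-mirror reflection positivity, STUB 2 exterior harmonicity at order `3 + 1`, STUB 3 the
analytic layer at order `3 + 1`, and STUB 4 concludes (flooding, removable singularities, GKS II + Lebowitz in the
limit, Liouville).  Rotation-free. -/
theorem edge_limitConnectedFour_eq_zero (hρ : ∀ δ ∈ Set.Ioc (0:ℝ) 1, 0 < ρ δ)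
    (hlim : HasPointwiseScalingLimit (criticalCorr 3) ρ S)
    (hnorm : ∀ n z, z ∉ NonCoincident 3 n → S n z = 0) (hnd : IsNondegenerateTwoPoint S)
    (htr : IsTranslationInvariant S) (hsc : IsScaleCovariant Δ S)
    (hiso : ∀ (R : EuclideanSpace ℝ (Fin 3) ≃ₗᵢ[ℝ] EuclideanSpace ℝ (Fin 3))
      (x : EuclideanSpace ℝ (Fin 3)), x ≠ 0 → S 2 ![0, R x] = S 2 ![0, x])
    (hΔ : Δ = 1 / 2) :
    ∀ z ∈ NonCoincident 3 4, limitConnectedFour S z = 0 := by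
  have hRP := stub_nineMirrorRP ρ S hρ hlim hnorm htr
  exact stub_edgeBocherLiouville ρ Δ S hρ hlim hnorm hnd htr hsc hiso hΔ
    (fun y hy n hn u hu => stub_exteriorHarmonic ρ Δ S hρ hlim hnorm hnd htr hsc hiso hRP hΔ 3 y hy n hn u hu)
    (fun y hy => stub_analyticOffFinite ρ Δ S hρ hlim hnorm hnd htr hsc hRP 3 y hy)

/-- **Interaction forces an anomalous dimension.**  For every instance of the crux hypotheses (H1)–(H7) with
`U₄ ≢ 0` on non-coincident quadruples, `1/2 < Δ`: the window gives `1/2 ≤ Δ` (`delta_mem_Icc_of_hyp`) and the edge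
is excluded by `edge_limitConnectedFour_eq_zero`.  Rotation-free; on route GaussianScaleMixture crux (E)
`IsingEuclidUpgradeR4NonGaussian` supplies `U₄ ≢ 0`, so every other line may assume a solid one-particle cone. -/
theorem half_lt_delta_of_hasNontrivialU4 (hρ : ∀ δ ∈ Set.Ioc (0:ℝ) 1, 0 < ρ δ)
    (hlim : HasPointwiseScalingLimit (criticalCorr 3) ρ S)
    (hnorm : ∀ n z, z ∉ NonCoincident 3 n → S n z = 0) (hnd : IsNondegenerateTwoPoint S)
    (htr : IsTranslationInvariant S) (hsc : IsScaleCovariant Δ S)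
    (hiso : ∀ (R : EuclideanSpace ℝ (Fin 3) ≃ₗᵢ[ℝ] EuclideanSpace ℝ (Fin 3))
      (x : EuclideanSpace ℝ (Fin 3)), x ≠ 0 → S 2 ![0, R x] = S 2 ![0, x])
    (hU4 : HasNontrivialU4 S) : 1 / 2 < Δ := by
  have hwin : Δ ∈ Set.Icc (1 / 2 : ℝ) 1 := delta_mem_Icc_of_hyp hρ hlim hnd hsc
  rcases eq_or_lt_of_le hwin.1 with heq | hlt
  · exfalso
    obtain ⟨z, hz, hne⟩ := hU4
    exact hne (edge_limitConnectedFour_eq_zero hρ hlim hnorm hnd htr hsc hiso heq.symm z hz)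
  · exact hlt

/-- **The edge instance of the crux, PROVED.**  Every instance of the crux hypotheses (H1)–(H7) with `Δ = 1/2` is
`O(3)` invariant at all orders: `U₄ ≡ 0` (`edge_limitConnectedFour_eq_zero`), hence all even orders are Wick sums of
the round `S₂` and odd orders vanish (`isRotationInvariant_of_gaussian`, Aizenman–Newman dichotomy). -/
theorem isRotationInvariant_of_delta_eq_half (hρ : ∀ δ ∈ Set.Ioc (0:ℝ) 1, 0 < ρ δ)
    (hlim : HasPointwiseScalingLimit (criticalCorr 3) ρ S)
    (hnorm : ∀ n z, z ∉ NonCoincident 3 n → S n z = 0) (hnd : IsNondegenerateTwoPoint S)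
    (htr : IsTranslationInvariant S) (hsc : IsScaleCovariant Δ S)
    (hiso : ∀ (R : EuclideanSpace ℝ (Fin 3) ≃ₗᵢ[ℝ] EuclideanSpace ℝ (Fin 3))
      (x : EuclideanSpace ℝ (Fin 3)), x ≠ 0 → S 2 ![0, R x] = S 2 ![0, x])
    (hΔ : Δ = 1 / 2) : IsRotationInvariant S :=
  isRotationInvariant_of_gaussian hlim hnorm htr hiso
    (edge_limitConnectedFour_eq_zero hρ hlim hnorm hnd htr hsc hiso hΔ)

/-- **`RotationUpgradeFromTwoPoint` closed modulo its open core** (the registered skeleton's composition, gen 3,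
with the five landed stubs inlined by name).  Hypothesis = registered STUB 5' `stub_interiorSigmaBound` verbatim,
universally quantified over instances: on the interior non-Gaussian stratum `1/2 < Δ ≤ 1`, `U₄ ≢ 0`, with
nine-mirror reflection positivity of all orders and the analytic layer available, the frame-`e₀` AXIS SIGMA BOUND
`‖e^{-uH} σ̂(y) e^{-vH}‖ ≤ C (u^{-Δ} + v^{-Δ})` (correlation-function form).  Conclusion = the crux.  Proof: Gaussian
locus `U₄ ≡ 0` by `isRotationInvariant_of_gaussian`; otherwise `1/2 < Δ ≤ 1` by `half_lt_delta_of_hasNontrivialU4` and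
`delta_mem_Icc_of_hyp`, the hypothesis (fed STUB 1 and STUB 3) gives the axis sigma bound, and the landed graft
`stub_sigmaBoundGraft` (quarter-turn-liouville machinery of crux stmt-1980 with base level `2` from (H7)) concludes.
This is the kernel-checked statement "crux stmt-8367 ⇐ one open energy bound", the same bound the sibling crux
stmt-1980 is closed modulo. -/
theorem rotationUpgradeFromTwoPoint_of_interiorSigmaBound :
    (∀ (ρ : ℝ → ℝ) (Δ : ℝ) (S : CorrFamily 3), (∀ δ ∈ Set.Ioc (0:ℝ) 1, 0 < ρ δ) →
      HasPointwiseScalingLimit (criticalCorr 3) ρ S →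
      (∀ n z, z ∉ NonCoincident 3 n → S n z = 0) → IsNondegenerateTwoPoint S →
      IsTranslationInvariant S → IsScaleCovariant Δ S →
      (∀ (R : EuclideanSpace ℝ (Fin 3) ≃ₗᵢ[ℝ] EuclideanSpace ℝ (Fin 3))
        (x : EuclideanSpace ℝ (Fin 3)), x ≠ 0 → S 2 ![0, R x] = S 2 ![0, x]) →
      1 / 2 < Δ → Δ ≤ 1 → HasNontrivialU4 S →
      (∀ n : EuclideanSpace ℝ (Fin 3),
        (∃ i j : Fin 3, i ≠ j ∧ (n = EuclideanSpace.single i 1 ∨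
          n = EuclideanSpace.single i 1 + EuclideanSpace.single j 1 ∨
          n = EuclideanSpace.single i 1 - EuclideanSpace.single j 1)) →
        ∀ (k : ℕ) (m : Fin k → ℕ) (A : (a : Fin k) → Fin (m a) → EuclideanSpace ℝ (Fin 3))
          (c : Fin k → ℝ), (∀ a i, 0 < inner ℝ (A a i) n) →
          0 ≤ ∑ a, ∑ b, c a * c b *
            S (m a + m b) (Fin.append (fun i => ((ℝ ∙ n)ᗮ).reflection (A a i)) (A b))) →
      (∀ (m : ℕ) (y : Fin m → EuclideanSpace ℝ (Fin 3)), Function.Injective y →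
        ∃ F : Finset (EuclideanSpace ℝ (Fin 3)),
          AnalyticOnNhd ℝ (fun x : EuclideanSpace ℝ (Fin 3) => S (m + 1) (Fin.cons x y))
            (Set.range y ∪ (F : Set (EuclideanSpace ℝ (Fin 3))))ᶜ) →
      ∃ C : ℝ, ∀ u v : ℝ, 0 < u → 0 < v → ∀ y : EuclideanSpace ℝ (Fin 3), y 0 = 0 →
        ∀ (m : ℕ) (k : Fin m → ℕ) (A : (a : Fin m) → Fin (k a) → EuclideanSpace ℝ (Fin 3)) (c : Fin m → ℝ)
          (m' : ℕ) (k' : Fin m' → ℕ) (B : (b : Fin m') → Fin (k' b) → EuclideanSpace ℝ (Fin 3))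
          (d : Fin m' → ℝ),
          (∀ a i, 0 < A a i 0) → (∀ b j, 0 < B b j 0) →
          (∑ a, ∑ b, c a * d b * S (k a + 1 + k' b)
              (Fin.append (Fin.append
                (fun i => axisReflection 0 (A a i + u • EuclideanSpace.single 0 1)) ![y])
                (fun j => B b j + v • EuclideanSpace.single 0 1))) ^ 2
            ≤ (C * (u ^ (-Δ) + v ^ (-Δ))) ^ 2 *
              (∑ a, ∑ a', c a * c a' * S (k a + k a')
                (Fin.append (fun i => axisReflection 0 (A a i)) (A a'))) *
              (∑ b, ∑ b', d b * d b' * S (k' b + k' b')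
                (Fin.append (fun j => axisReflection 0 (B b j)) (B b')))) →
    Summit.CriticalPhenomena.Ising3DConformalLimit.Theses.GaussianScaleMixture.RotationUpgradeFromTwoPoint := by
  intro h5 ρ Δ S hρ hlim hnorm hnd htr hsc hiso
  by_cases hU4 : HasNontrivialU4 S
  · -- the non-Gaussian branch: edge excluded, interior = sigma bound + graft
    have hwin : Δ ∈ Set.Icc (1 / 2 : ℝ) 1 := delta_mem_Icc_of_hyp hρ hlim hnd hsc
    have hlt : 1 / 2 < Δ := half_lt_delta_of_hasNontrivialU4 hρ hlim hnorm hnd htr hsc hiso hU4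
    have hRP := stub_nineMirrorRP ρ S hρ hlim hnorm htr
    exact stub_sigmaBoundGraft ρ Δ S hρ hlim hnorm hnd htr hsc hiso
      (h5 ρ Δ S hρ hlim hnorm hnd htr hsc hiso hlt hwin.2 hU4 hRP
        (fun m y hy => stub_analyticOffFinite ρ Δ S hρ hlim hnorm hnd htr hsc hRP m y hy))
  · -- the Gaussian locus
    have hU : ∀ z ∈ NonCoincident 3 4, limitConnectedFour S z = 0 := by
      intro z hz
      by_contra hne
      exact hU4 ⟨z, hz, hne⟩
    exact isRotationInvariant_of_gaussian hlim hnorm htr hiso hU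

/-- **`RotationUpgradeFromTwoPoint` closed modulo its open core in DIMENSIONLESS form** (skeleton gen 3.2):
the same composition with the hypothesis weakened to the frame-`e₀` UNIT SIGMA BOUND `‖e^{-H} σ̂(y) e^{-H}‖ ≤ C₁`
(registered stub `stub_interiorUnitSigmaBound`, the `u = v = 1` instance; the two-sided bound follows by the landed
`stub_axisSigmaBound_of_unit` of line `quarter-turn-liouville` — scale covariance and contraction of the transfer
semigroup — from the `LimitStructure` that `stub_limitRegularity` and the QT `stub_nineMirrorRP` provide). -/
theorem rotationUpgradeFromTwoPoint_of_interiorUnitSigmaBound :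
    (∀ (ρ : ℝ → ℝ) (Δ : ℝ) (S : CorrFamily 3), (∀ δ ∈ Set.Ioc (0:ℝ) 1, 0 < ρ δ) →
      HasPointwiseScalingLimit (criticalCorr 3) ρ S →
      (∀ n z, z ∉ NonCoincident 3 n → S n z = 0) → IsNondegenerateTwoPoint S →
      IsTranslationInvariant S → IsScaleCovariant Δ S →
      (∀ (R : EuclideanSpace ℝ (Fin 3) ≃ₗᵢ[ℝ] EuclideanSpace ℝ (Fin 3))
        (x : EuclideanSpace ℝ (Fin 3)), x ≠ 0 → S 2 ![0, R x] = S 2 ![0, x]) →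
      1 / 2 < Δ → Δ ≤ 1 → HasNontrivialU4 S →
      (∀ n : EuclideanSpace ℝ (Fin 3),
        (∃ i j : Fin 3, i ≠ j ∧ (n = EuclideanSpace.single i 1 ∨
          n = EuclideanSpace.single i 1 + EuclideanSpace.single j 1 ∨
          n = EuclideanSpace.single i 1 - EuclideanSpace.single j 1)) →
        ∀ (k : ℕ) (m : Fin k → ℕ) (A : (a : Fin k) → Fin (m a) → EuclideanSpace ℝ (Fin 3))
          (c : Fin k → ℝ), (∀ a i, 0 < inner ℝ (A a i) n) →
          0 ≤ ∑ a, ∑ b, c a * c b *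
            S (m a + m b) (Fin.append (fun i => ((ℝ ∙ n)ᗮ).reflection (A a i)) (A b))) →
      (∀ (m : ℕ) (y : Fin m → EuclideanSpace ℝ (Fin 3)), Function.Injective y →
        ∃ F : Finset (EuclideanSpace ℝ (Fin 3)),
          AnalyticOnNhd ℝ (fun x : EuclideanSpace ℝ (Fin 3) => S (m + 1) (Fin.cons x y))
            (Set.range y ∪ (F : Set (EuclideanSpace ℝ (Fin 3))))ᶜ) →
      ∃ C₁ : ℝ, ∀ y : EuclideanSpace ℝ (Fin 3), y 0 = 0 →
        ∀ (m : ℕ) (k : Fin m → ℕ) (A : (a : Fin m) → Fin (k a) → EuclideanSpace ℝ (Fin 3)) (c : Fin m → ℝ)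
          (m' : ℕ) (k' : Fin m' → ℕ) (B : (b : Fin m') → Fin (k' b) → EuclideanSpace ℝ (Fin 3))
          (d : Fin m' → ℝ),
          (∀ a i, 0 < A a i 0) → (∀ b j, 0 < B b j 0) →
          (∑ a, ∑ b, c a * d b * S (k a + 1 + k' b)
              (Fin.append (Fin.append
                (fun i => axisReflection 0 (A a i + EuclideanSpace.single 0 1)) ![y])
                (fun j => B b j + EuclideanSpace.single 0 1))) ^ 2
            ≤ C₁ ^ 2 *
              (∑ a, ∑ a', c a * c a' * S (k a + k a')
                (Fin.append (fun i => axisReflection 0 (A a i)) (A a'))) *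
              (∑ b, ∑ b', d b * d b' * S (k' b + k' b')
                (Fin.append (fun j => axisReflection 0 (B b j)) (B b')))) →
    Summit.CriticalPhenomena.Ising3DConformalLimit.Theses.GaussianScaleMixture.RotationUpgradeFromTwoPoint := by
  intro h5 ρ Δ S hρ hlim hnorm hnd htr hsc hiso
  by_cases hU4 : HasNontrivialU4 S
  · have hwin : Δ ∈ Set.Icc (1 / 2 : ℝ) 1 := delta_mem_Icc_of_hyp hρ hlim hnd hsc
    have hlt : 1 / 2 < Δ := half_lt_delta_of_hasNontrivialU4 hρ hlim hnorm hnd htr hsc hiso hU4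
    have hRP := stub_nineMirrorRP ρ S hρ hlim hnorm htr
    have hH : Cruxes.LimitRotationInvariant.QuarterTurnLiouville.CruxHyp ρ Δ S :=
      ⟨hρ, hlim, hnorm, hnd, htr, hsc⟩
    have hL : LimitStructure Δ S :=
      ⟨stub_limitRegularity ρ Δ S hH,
        Cruxes.LimitRotationInvariant.QuarterTurnLiouville.stub_nineMirrorRP ρ Δ S hH⟩
    exact stub_sigmaBoundGraft ρ Δ S hρ hlim hnorm hnd htr hsc hiso
      (stub_axisSigmaBound_of_unit Δ S hL
        (h5 ρ Δ S hρ hlim hnorm hnd htr hsc hiso hlt hwin.2 hU4 hRP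
          (fun m y hy => stub_analyticOffFinite ρ Δ S hρ hlim hnorm hnd htr hsc hRP m y hy)))
  · have hU : ∀ z ∈ NonCoincident 3 4, limitConnectedFour S z = 0 := by
      intro z hz
      by_contra hne
      exact hU4 ⟨z, hz, hne⟩
    exact isRotationInvariant_of_gaussian hlim hnorm htr hiso hU

end Summit.CriticalPhenomena.Ising3DConformalLimit.Cruxes.RotationUpgradeFromTwoPoint.NullLaplacianEdgeGaussianity

end
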